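import Mathlib
import HarnessLib
import Summits.Ventures.LatticeQCDFlow.Scoring.GaussianStudentBoundary
import Summits.Ventures.LatticeQCDFlow.Scoring.StudentFunctionalThresholds

/-!
# STUDENT-TYPE THRESHOLDS EXIST FOR EVERY NOMINAL LEVEL (one sample and two samples):
# `t ↦ N(0,1)^{⊗a}{g | a·ḡ² ≤ t²·s²(g)}` and `t ↦ (N(0,1)^{⊗a})^{⊗2}{(g,h) | a·(ḡ − h̄)² ≤ t²·(s²(g) + s²(h))}`
# are continuous, vanish at `0`, tend to `1`, and take every value `p ∈ (0, 1)` at some `t > 0`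

HONEST FRAMING: exact (Metropolis-corrected) sampling algorithms for lattice gauge theory;
figures of merit are autocorrelation/cost numbers at stated couplings and volumes; no
continuum-physics claim.

Venture `LatticeQCDFlow` (cell pub-lqcd), topic `Scoring`; FANOUT row 4 (`s0-u1-b`, GEN-32).
NEW WORK of the cell (classical; not in Mathlib), no definition, nothing cited as a fact.

At a FIXED number `a ≥ 2` of batches (or replicas) the batch-means interval `x̄ ± t·SE` covers
`π(f)` with probability tending to the Student-type Gaussian functional
`F_a(t) = N(0,1)^{⊗a}{g | a·ḡ² ≤ t²·s²(g)}`, and the fixed-count A-vs-B agreement criterion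
`|x̄_A − x̄_B| ≤ t·√(SE_A² + SE_B²)` holds with probability tending to
`F⁽²⁾_a(t) = (N(0,1)^{⊗a})^{⊗2}{(g, h) | a·(ḡ − h̄)² ≤ t²·(s²(g) + s²(h))}` (the cell's fixed-count
coverage theorems).  To USE these calibrations one needs, for a nominal level `p`, a threshold `t`
with `F(t) = p` — the Student quantile.  This file proves, without densities, that such a
threshold exists for every `p ∈ (0, 1)` (it is unique by `Scoring/GaussianStudentMonotone.lean`):
the threshold calculus of `Scoring/StudentFunctionalThresholds.lean` applies because the level
sets are null (`Scoring/GaussianStudentBoundary.lean`) and `{s²(g) = 0}` (resp.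
`{s²(g) + s²(h) = 0} ⊆ {s²(g) = 0} × univ`) is null
(`StudentFunctionalThresholds.pi_gaussianReal_sampleVariance_eq_zero_null`).

## Content

* `continuous_pi_gaussianReal_student`, `pi_gaussianReal_student_zero`,
  `tendsto_pi_gaussianReal_student_atTop`, **`pi_gaussianReal_student_threshold_exists`** —
  one sample: continuity, `F_a(0) = 0`, `F_a(n) → 1`, `∀ p ∈ (0,1), ∃ t > 0, F_a(t) = p`.
* `continuous_pi_gaussianReal_twoSample_student`, `pi_gaussianReal_twoSample_student_zero`,
  `tendsto_pi_gaussianReal_twoSample_student_atTop`,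
  **`pi_gaussianReal_twoSample_student_threshold_exists`** — the same for `F⁽²⁾_a`.

Depends on: `Scoring/GaussianStudentBoundary`, `Scoring/StudentFunctionalThresholds`.  [ours]
throughout.
-/

open MeasureTheory ProbabilityTheory Filter Topology

namespace Summit.Ventures.LatticeQCDFlow.Scoring

section Quantile

/-- **`t ↦ F_a(t) = N(0,1)^{⊗a}{g | a·ḡ² ≤ t²·s²(g)}` IS CONTINUOUS** (`a ≥ 2`). [ours] -/
theorem continuous_pi_gaussianReal_student {a : ℕ} (ha : 2 ≤ a) :
    Continuous fun t : ℝ => (Measure.pi fun _ : Fin a => gaussianReal 0 1).real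
      {g : Fin a → ℝ | (a : ℝ) * ((∑ i, g i) / (a : ℝ)) ^ 2
          ≤ t ^ 2 * ((∑ j, (g j - (∑ i, g i) / (a : ℝ)) ^ 2) / ((a : ℝ) - 1))} := by
  obtain ⟨k, rfl⟩ := Nat.exists_eq_succ_of_ne_zero (show a ≠ 0 by omega)
  have hk : 1 ≤ k := by omega
  exact continuous_measureReal_studentSublevel (Measure.pi fun _ : Fin (k + 1) => gaussianReal 0 1)
    (A := fun g : Fin (k + 1) → ℝ => ((k + 1 : ℕ) : ℝ) * ((∑ i, g i) / ((k + 1 : ℕ) : ℝ)) ^ 2)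
    (D := fun g : Fin (k + 1) → ℝ =>
      (∑ j, (g j - (∑ i, g i) / ((k + 1 : ℕ) : ℝ)) ^ 2) / (((k + 1 : ℕ) : ℝ) - 1))
    (by fun_prop) (by fun_prop) (fun t => pi_gaussianReal_studentBoundary_eq_zero k hk t)

/-- **`F_a(0) = 0`**: the event `{a·ḡ² ≤ 0} = {ḡ = 0}` is null. [ours] -/
theorem pi_gaussianReal_student_zero {a : ℕ} (ha : 2 ≤ a) :
    (Measure.pi fun _ : Fin a => gaussianReal 0 1).real
      {g : Fin a → ℝ | (a : ℝ) * ((∑ i, g i) / (a : ℝ)) ^ 2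
          ≤ (0 : ℝ) ^ 2 * ((∑ j, (g j - (∑ i, g i) / (a : ℝ)) ^ 2) / ((a : ℝ) - 1))} = 0 := by
  obtain ⟨k, rfl⟩ := Nat.exists_eq_succ_of_ne_zero (show a ≠ 0 by omega)
  have hk : 1 ≤ k := by omega
  exact measureReal_studentSublevel_zero (Measure.pi fun _ : Fin (k + 1) => gaussianReal 0 1)
    (A := fun g : Fin (k + 1) → ℝ => ((k + 1 : ℕ) : ℝ) * ((∑ i, g i) / ((k + 1 : ℕ) : ℝ)) ^ 2)
    (D := fun g : Fin (k + 1) → ℝ =>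
      (∑ j, (g j - (∑ i, g i) / ((k + 1 : ℕ) : ℝ)) ^ 2) / (((k + 1 : ℕ) : ℝ) - 1))
    (fun g => by positivity) (pi_gaussianReal_studentBoundary_eq_zero k hk 0)

/-- **`F_a(n) → 1`**: `{s²(g) = 0}` is null. [ours] -/
theorem tendsto_pi_gaussianReal_student_atTop {a : ℕ} (ha : 2 ≤ a) :
    Tendsto (fun n : ℕ => (Measure.pi fun _ : Fin a => gaussianReal 0 1).real
      {g : Fin a → ℝ | (a : ℝ) * ((∑ i, g i) / (a : ℝ)) ^ 2
          ≤ (n : ℝ) ^ 2 * ((∑ j, (g j - (∑ i, g i) / (a : ℝ)) ^ 2) / ((a : ℝ) - 1))})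
      atTop (𝓝 1) := by
  obtain ⟨k, rfl⟩ : ∃ k, a = k + 2 := ⟨a - 2, by omega⟩
  have hapos : (0 : ℝ) < ((k + 2 : ℕ) : ℝ) - 1 := by push_cast; linarith
  refine tendsto_measureReal_studentSublevel_atTop (Measure.pi fun _ : Fin (k + 2) => gaussianReal 0 1)
    (A := fun g : Fin (k + 2) → ℝ => ((k + 2 : ℕ) : ℝ) * ((∑ i, g i) / ((k + 2 : ℕ) : ℝ)) ^ 2)
    (D := fun g : Fin (k + 2) → ℝ =>
      (∑ j, (g j - (∑ i, g i) / ((k + 2 : ℕ) : ℝ)) ^ 2) / (((k + 2 : ℕ) : ℝ) - 1))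
    (by fun_prop) (by fun_prop)
    (fun g => div_nonneg (Finset.sum_nonneg fun j _ => sq_nonneg _) hapos.le) ?_
  -- `{D = 0} = {∑ (gⱼ − ḡ)² = 0}`
  have hset : {g : Fin (k + 2) → ℝ |
        (∑ j, (g j - (∑ i, g i) / ((k + 2 : ℕ) : ℝ)) ^ 2) / (((k + 2 : ℕ) : ℝ) - 1) = 0}
      = {x : Fin (k + 2) → ℝ | ∑ j, (x j - (∑ i, x i) / ((k + 2 : ℕ) : ℝ)) ^ 2 = 0} := by
    ext g
    simp only [Set.mem_setOf_eq, div_eq_zero_iff, hapos.ne', or_false]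
  rw [hset]
  exact pi_gaussianReal_sampleVariance_eq_zero_null k

/-- **STUDENT-TYPE THRESHOLDS EXIST FOR EVERY NOMINAL LEVEL.**  For `a ≥ 2` batches and every
`p ∈ (0, 1)` there is a threshold `t > 0` with `N(0,1)^{⊗a}{g | a·ḡ² ≤ t²·s²(g)} = p`: the
fixed-batch-count interval `x̄ ± t·SE` then has asymptotic coverage EXACTLY `p` (by the cell's
fixed-batch-count coverage theorem); `t` is the Student `t_{a−1}` quantile, characterised without
densities (unique by `Scoring/GaussianStudentMonotone.lean`). [ours] -/
theorem pi_gaussianReal_student_threshold_exists {a : ℕ} (ha : 2 ≤ a) {p : ℝ} (hp0 : 0 < p)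
    (hp1 : p < 1) :
    ∃ t : ℝ, 0 < t ∧ (Measure.pi fun _ : Fin a => gaussianReal 0 1).real
      {g : Fin a → ℝ | (a : ℝ) * ((∑ i, g i) / (a : ℝ)) ^ 2
          ≤ t ^ 2 * ((∑ j, (g j - (∑ i, g i) / (a : ℝ)) ^ 2) / ((a : ℝ) - 1))} = p :=
  exists_pos_threshold_of_continuous (continuous_pi_gaussianReal_student ha)
    (pi_gaussianReal_student_zero ha) (tendsto_pi_gaussianReal_student_atTop ha) hp0 hp1

end Quantile

section TwoSampleQuantile

/-- **`t ↦ F(t)` IS CONTINUOUS** (`a ≥ 2`). [ours] -/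
theorem continuous_pi_gaussianReal_twoSample_student {a : ℕ} (ha : 2 ≤ a) :
    Continuous fun t : ℝ => ((Measure.pi fun _ : Fin a => gaussianReal 0 1).prod
        (Measure.pi fun _ : Fin a => gaussianReal 0 1)).real
      {p : (Fin a → ℝ) × (Fin a → ℝ) | (a : ℝ) * ((∑ i, p.1 i) / (a : ℝ) - (∑ i, p.2 i) / (a : ℝ)) ^ 2
          ≤ t ^ 2 * (((∑ j, (p.1 j - (∑ i, p.1 i) / (a : ℝ)) ^ 2) / ((a : ℝ) - 1))
            + ((∑ j, (p.2 j - (∑ i, p.2 i) / (a : ℝ)) ^ 2) / ((a : ℝ) - 1)))} := by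
  obtain ⟨k, rfl⟩ := Nat.exists_eq_succ_of_ne_zero (show a ≠ 0 by omega)
  have hk : 1 ≤ k := by omega
  exact continuous_measureReal_studentSublevel
    ((Measure.pi fun _ : Fin (k + 1) => gaussianReal 0 1).prod
      (Measure.pi fun _ : Fin (k + 1) => gaussianReal 0 1))
    (A := fun p : (Fin (k + 1) → ℝ) × (Fin (k + 1) → ℝ) =>
      ((k + 1 : ℕ) : ℝ) * ((∑ i, p.1 i) / ((k + 1 : ℕ) : ℝ) - (∑ i, p.2 i) / ((k + 1 : ℕ) : ℝ)) ^ 2)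
    (D := fun p : (Fin (k + 1) → ℝ) × (Fin (k + 1) → ℝ) =>
      ((∑ j, (p.1 j - (∑ i, p.1 i) / ((k + 1 : ℕ) : ℝ)) ^ 2) / (((k + 1 : ℕ) : ℝ) - 1))
        + ((∑ j, (p.2 j - (∑ i, p.2 i) / ((k + 1 : ℕ) : ℝ)) ^ 2) / (((k + 1 : ℕ) : ℝ) - 1)))
    (by fun_prop) (by fun_prop) (fun t => pi_gaussianReal_twoSample_studentBoundary_eq_zero k hk t)

/-- **`F(0) = 0`**: the event `{a·(ḡ − h̄)² ≤ 0} = {ḡ = h̄}` is null. [ours] -/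
theorem pi_gaussianReal_twoSample_student_zero {a : ℕ} (ha : 2 ≤ a) :
    ((Measure.pi fun _ : Fin a => gaussianReal 0 1).prod
        (Measure.pi fun _ : Fin a => gaussianReal 0 1)).real
      {p : (Fin a → ℝ) × (Fin a → ℝ) | (a : ℝ) * ((∑ i, p.1 i) / (a : ℝ) - (∑ i, p.2 i) / (a : ℝ)) ^ 2
          ≤ (0 : ℝ) ^ 2 * (((∑ j, (p.1 j - (∑ i, p.1 i) / (a : ℝ)) ^ 2) / ((a : ℝ) - 1))
            + ((∑ j, (p.2 j - (∑ i, p.2 i) / (a : ℝ)) ^ 2) / ((a : ℝ) - 1)))} = 0 := by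
  obtain ⟨k, rfl⟩ := Nat.exists_eq_succ_of_ne_zero (show a ≠ 0 by omega)
  have hk : 1 ≤ k := by omega
  exact measureReal_studentSublevel_zero
    ((Measure.pi fun _ : Fin (k + 1) => gaussianReal 0 1).prod
      (Measure.pi fun _ : Fin (k + 1) => gaussianReal 0 1))
    (A := fun p : (Fin (k + 1) → ℝ) × (Fin (k + 1) → ℝ) =>
      ((k + 1 : ℕ) : ℝ) * ((∑ i, p.1 i) / ((k + 1 : ℕ) : ℝ) - (∑ i, p.2 i) / ((k + 1 : ℕ) : ℝ)) ^ 2)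
    (D := fun p : (Fin (k + 1) → ℝ) × (Fin (k + 1) → ℝ) =>
      ((∑ j, (p.1 j - (∑ i, p.1 i) / ((k + 1 : ℕ) : ℝ)) ^ 2) / (((k + 1 : ℕ) : ℝ) - 1))
        + ((∑ j, (p.2 j - (∑ i, p.2 i) / ((k + 1 : ℕ) : ℝ)) ^ 2) / (((k + 1 : ℕ) : ℝ) - 1)))
    (fun p => by positivity) (pi_gaussianReal_twoSample_studentBoundary_eq_zero k hk 0)

/-- **`F(n) → 1`**: `{s²(g) + s²(h) = 0} ⊆ {s²(g) = 0} × univ` is null. [ours] -/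
theorem tendsto_pi_gaussianReal_twoSample_student_atTop {a : ℕ} (ha : 2 ≤ a) :
    Tendsto (fun n : ℕ => ((Measure.pi fun _ : Fin a => gaussianReal 0 1).prod
        (Measure.pi fun _ : Fin a => gaussianReal 0 1)).real
      {p : (Fin a → ℝ) × (Fin a → ℝ) | (a : ℝ) * ((∑ i, p.1 i) / (a : ℝ) - (∑ i, p.2 i) / (a : ℝ)) ^ 2
          ≤ (n : ℝ) ^ 2 * (((∑ j, (p.1 j - (∑ i, p.1 i) / (a : ℝ)) ^ 2) / ((a : ℝ) - 1))
            + ((∑ j, (p.2 j - (∑ i, p.2 i) / (a : ℝ)) ^ 2) / ((a : ℝ) - 1)))})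
      atTop (𝓝 1) := by
  obtain ⟨k, rfl⟩ : ∃ k, a = k + 2 := ⟨a - 2, by omega⟩
  have hapos : (0 : ℝ) < ((k + 2 : ℕ) : ℝ) - 1 := by push_cast; linarith
  have hQnn : ∀ x : Fin (k + 2) → ℝ, 0 ≤ ∑ j, (x j - (∑ i, x i) / ((k + 2 : ℕ) : ℝ)) ^ 2 :=
    fun x => Finset.sum_nonneg fun j _ => sq_nonneg _
  refine tendsto_measureReal_studentSublevel_atTop
    ((Measure.pi fun _ : Fin (k + 2) => gaussianReal 0 1).prod
      (Measure.pi fun _ : Fin (k + 2) => gaussianReal 0 1))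
    (A := fun p : (Fin (k + 2) → ℝ) × (Fin (k + 2) → ℝ) =>
      ((k + 2 : ℕ) : ℝ) * ((∑ i, p.1 i) / ((k + 2 : ℕ) : ℝ) - (∑ i, p.2 i) / ((k + 2 : ℕ) : ℝ)) ^ 2)
    (D := fun p : (Fin (k + 2) → ℝ) × (Fin (k + 2) → ℝ) =>
      ((∑ j, (p.1 j - (∑ i, p.1 i) / ((k + 2 : ℕ) : ℝ)) ^ 2) / (((k + 2 : ℕ) : ℝ) - 1))
        + ((∑ j, (p.2 j - (∑ i, p.2 i) / ((k + 2 : ℕ) : ℝ)) ^ 2) / (((k + 2 : ℕ) : ℝ) - 1)))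
    (by fun_prop) (by fun_prop)
    (fun p => add_nonneg (div_nonneg (hQnn p.1) hapos.le) (div_nonneg (hQnn p.2) hapos.le)) ?_
  -- `{D = 0} ⊆ {s²(g) = 0} × univ`, a null set
  have hsub : {p : (Fin (k + 2) → ℝ) × (Fin (k + 2) → ℝ) |
        ((∑ j, (p.1 j - (∑ i, p.1 i) / ((k + 2 : ℕ) : ℝ)) ^ 2) / (((k + 2 : ℕ) : ℝ) - 1))
          + ((∑ j, (p.2 j - (∑ i, p.2 i) / ((k + 2 : ℕ) : ℝ)) ^ 2) / (((k + 2 : ℕ) : ℝ) - 1)) = 0}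
      ⊆ {x : Fin (k + 2) → ℝ | ∑ j, (x j - (∑ i, x i) / ((k + 2 : ℕ) : ℝ)) ^ 2 = 0}
        ×ˢ (Set.univ : Set (Fin (k + 2) → ℝ)) := by
    intro p hp
    simp only [Set.mem_setOf_eq] at hp
    simp only [Set.mem_prod, Set.mem_setOf_eq, Set.mem_univ, and_true]
    have h1 : 0 ≤ (∑ j, (p.1 j - (∑ i, p.1 i) / ((k + 2 : ℕ) : ℝ)) ^ 2) / (((k + 2 : ℕ) : ℝ) - 1) :=
      div_nonneg (hQnn p.1) hapos.le
    have h2 : 0 ≤ (∑ j, (p.2 j - (∑ i, p.2 i) / ((k + 2 : ℕ) : ℝ)) ^ 2) / (((k + 2 : ℕ) : ℝ) - 1) :=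
      div_nonneg (hQnn p.2) hapos.le
    have h1z : (∑ j, (p.1 j - (∑ i, p.1 i) / ((k + 2 : ℕ) : ℝ)) ^ 2) / (((k + 2 : ℕ) : ℝ) - 1) = 0 := by
      linarith
    rcases (div_eq_zero_iff.1 h1z) with h | h
    · exact h
    · exact absurd h hapos.ne'
  refine measure_mono_null hsub ?_
  rw [Measure.prod_prod, pi_gaussianReal_sampleVariance_eq_zero_null k, zero_mul]

/-- **TWO-SAMPLE STUDENT-TYPE THRESHOLDS EXIST FOR EVERY NOMINAL LEVEL.**  For `a ≥ 2` batches per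
run (replicas per arm) and every `p ∈ (0, 1)` there is `t > 0` with
`(N(0,1)^{⊗a})^{⊗2}{(g, h) | a·(ḡ − h̄)² ≤ t²·(s²(g) + s²(h))} = p`: the fixed-count agreement
criterion `|x̄_A − x̄_B| ≤ t·√(SE_A² + SE_B²)` then holds with asymptotic probability EXACTLY `p`
for two runs sampling the same law (`t` plays the role of the Student `t_{2a−2}` quantile). [ours] -/
theorem pi_gaussianReal_twoSample_student_threshold_exists {a : ℕ} (ha : 2 ≤ a) {p : ℝ}
    (hp0 : 0 < p) (hp1 : p < 1) :
    ∃ t : ℝ, 0 < t ∧ ((Measure.pi fun _ : Fin a => gaussianReal 0 1).prod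
        (Measure.pi fun _ : Fin a => gaussianReal 0 1)).real
      {q : (Fin a → ℝ) × (Fin a → ℝ) | (a : ℝ) * ((∑ i, q.1 i) / (a : ℝ) - (∑ i, q.2 i) / (a : ℝ)) ^ 2
          ≤ t ^ 2 * (((∑ j, (q.1 j - (∑ i, q.1 i) / (a : ℝ)) ^ 2) / ((a : ℝ) - 1))
            + ((∑ j, (q.2 j - (∑ i, q.2 i) / (a : ℝ)) ^ 2) / ((a : ℝ) - 1)))} = p :=
  exists_pos_threshold_of_continuous (continuous_pi_gaussianReal_twoSample_student ha)
    (pi_gaussianReal_twoSample_student_zero ha) (tendsto_pi_gaussianReal_twoSample_student_atTop ha)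
    hp0 hp1

end TwoSampleQuantile

end Summit.Ventures.LatticeQCDFlow.Scoring
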